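import Mathlib.NumberTheory.LSeries.Convolution
import Literature.NumberTheory.EllipticCurves.ArtinFormalismSemistableLocalProofs
import Literature.NumberTheory.EllipticCurves.BSDQuadraticDescentProofs
import Literature.NumberTheory.DiophantineGeometry.LocalReductionIsSemistableAtProofs
import Literature.NumberTheory.LFunctions.AbelianFieldDedekindZeta
import HarnessLib

/-!
# Artin formalism for `L(E/F, s)`, `F ⊆ ℚ(ζ_m)` an abelian field, as an identity of formal Euler
# products with primitive twists: `L(E_F) · ∏_{v not semistable} Ψ_F(v) = ∏_{χ ∈ X(F)} χ⋆ • L(E)`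

`Proofs` file (theorems only) in topic `NumberTheory/EllipticCurves`.  Let `E/ℚ` be an elliptic
curve (Weierstrass model `W`), `L ⊇ ℚ` an `m`-th cyclotomic field
(`IsCyclotomicExtension {m} ℚ L`), `F ⊆ L` an intermediate field with character group
`X(F) = {χ mod m : χ(a_σ) = 1 ∀ σ ∈ Gal(L/F)}` (as in the tree's
`Literature.NumberTheory.LFunctions.AbelianFieldDedekindZeta`, Washington Thm. 3.7 / 4.3) and
`χ⋆ = χ.primitiveCharacter` the primitive character inducing `χ`.  For Mathlib's formal Hasse–Weil
Euler products (`WeierstrassCurve.LFunction : ArithmeticFunction ℤ`, the Euler product over all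
finite places of the local Euler factors of local minimal models) we prove:

* `WeierstrassCurve.intCoe_finprod_localEulerFactor_baseChange_eq_prod_primitiveTwist` — **the
  local Artin identity at a place `v` of semistable reduction of `E`, ramified in `F` or not**:
  `∏_{w ∣ v} L_w(E_F, N w^{-s})⁻¹ = ∏_{χ ∈ X(F)} L_v(E, χ⋆(p) p^{-s})⁻¹` (`p = N v`; the factors with
  `p ∣ cond χ⋆` are trivial).  Every `w ∣ v` has the same residue degree `f₀` and
  `L_w(E_F, T) = (1 - α^{f₀}T)(1 - β^{f₀}T)` where `L_v(E, T) = (1 - αT)(1 - βT)`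
  (`WeierstrassCurve.map_localPolynomialAt_baseChange_eq_of_isSemistableAt`, Silverman *AEC*
  V.2.3.1, VII.5.4, §C.16 — at places ramified in `F` this needs the semistability of `E`), there
  are `g` of them with `g f₀ = [G : HI]` (`AbelianSplitting.card_splittingType_mul_orderOf`), and
  `∏_{χ ∈ X(F)} (1 - χ⋆(p) γ T) = (1 - (γT)^{f₀})^g` (`AbelianDedekindZeta.prod_characterGroup_one_sub_primitive_mul`,
  the Euler factor at `p` of `ζ_F = ∏_χ L(χ⋆, s)`, Washington Thm. 4.3, taken at `T ↦ αT, βT`).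
* `WeierstrassCurve.prod_primitiveTwist_intCoe_localEulerFactor_eq_one_of_hasAdditiveReductionAt`
  — at a place of additive reduction of `E` every `χ⋆ • L_v(E, ·)⁻¹` is `1` (`L_v(E, T) = 1`).
* `WeierstrassCurve.intCoe_LFunction_baseChange_mul_eq_prod_primitiveTwist` — **the global
  identity**: with `S` the (finite) set of places where `E` is not semistable and
  `Ψ_F(v) = ∏_{w ∣ v} L_w(E_F, N w^{-s})` the inverse of the Euler factors of `E_F` above `v`,
  `L(E_F) · ∏_{v ∈ S} Ψ_F(v) = ∏_{χ ∈ X(F)} χ⋆ • L(E)` as formal Dirichlet series over `ℂ`, where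
  `χ⋆ • L(E) = ∑ χ⋆(n) aₙ(E) n^{-s}` is the twist by the **primitive** character;
* `WeierstrassCurve.intCoe_LFunction_baseChange_eq_prod_primitiveTwist_of_forall` — if moreover
  `E_F` has additive reduction at every place above a place of additive reduction of `E`, then
  `L(E_F) = ∏_{χ ∈ X(F)} χ⋆ • L(E)` exactly; in particular for `E/ℚ` semistable
  (`WeierstrassCurve.intCoe_LFunction_baseChange_eq_prod_primitiveTwist_of_isSemistable`).

This is Artin formalism `L(E/F, s) = ∏_χ L(E ⊗ χ, s)` (Ireland–Rosen Prop. 20.5.4 (b) for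
quadratic `F`, `L(E/K, s) = L(E, s) L(E_D, s)`) with the true Euler factors at every prime where
`E` is semistable: there the local factor of `E ⊗ χ` at `p` is `L_p(E, χ⋆(p) T)` (trivial when
`χ⋆` is ramified at `p`), which is the `p`-factor of the primitive twist `∑ χ⋆(n) aₙ n^{-s}`; at the
places of additive reduction of `E` the right-hand side has trivial factors and the discrepancy
`Ψ_F(v)` is `1` unless `E` acquires semistable reduction above `v`.  The unramified places and the
characters modulo `m` (imprimitive twists) were first done summit-side
(`Summits/BirchSwinnertonDyer/…/PlecticLegsArtinBaseChange{EulerLemmas,EulerLocal,Euler}.lean`,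
route `PlecticLegs`); `Literature/` cannot import `Summits/`, so the Euler-product bookkeeping
lemmas of those files are repeated here (`private`), the twisting lemmas for an arbitrary
completely multiplicative `ψ : ℕ → ℂ`.

## References

* K. Ireland, M. Rosen, *A Classical Introduction to Modern Number Theory*, 2nd ed. (1990),
  Ch. 20 §5, Prop. 20.5.4 (b) (PDF p. 353). [IrelandRosen1990]
* L. C. Washington, *Introduction to Cyclotomic Fields*, 2nd ed. (1997), Thm. 3.7, Thm. 4.3.
  [Washington1997]
* J. H. Silverman, *The Arithmetic of Elliptic Curves*, 2nd ed. (2009), V.2.3.1, VII.5.4, §C.16.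
  [SilvermanAEC2009]
-/

noncomputable section

open scoped Classical NumberField
open Filter IsDedekindDomain NumberField Polynomial

/-! ## Euler products: coercion `ℤ → ℂ`, finite products, finite support, twists -/

namespace ArithmeticFunction

section EulerProduct

variable {ι : Type*}

/-- A family converging to `1` coefficientwise stays so after the coercion `ℤ → ℂ`. [folklore] -/
private theorem eventually_intCoe_apply_eq_one {f : ι → ArithmeticFunction ℤ}
    (hf : ∀ n, ∀ᶠ i in cofinite, f i n = (1 : ArithmeticFunction ℤ) n) (n : ℕ) :
    ∀ᶠ i in cofinite, (f i : ArithmeticFunction ℂ) n = (1 : ArithmeticFunction ℂ) n := by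
  filter_upwards [hf n] with i hi
  rw [intCoe_apply, hi, ← intCoe_apply, intCoe_one]

/-- Coercion `ℤ → ℂ` of a finite product of arithmetic functions. [folklore] -/
private theorem intCoe_finset_prod {α : Type*} (s : Finset α) (f : α → ArithmeticFunction ℤ) :
    ((∏ i ∈ s, f i : ArithmeticFunction ℤ) : ArithmeticFunction ℂ) =
      ∏ i ∈ s, (f i : ArithmeticFunction ℂ) := by
  induction s using Finset.induction_on with
  | empty => simp
  | insert a s ha ih => rw [Finset.prod_insert ha, Finset.prod_insert ha, intCoe_mul, ih]

/-- The coercion `ℤ → ℂ` commutes with Euler products (both are coefficientwise limits of the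
finite partial products). [folklore] -/
private theorem intCoe_eulerProduct (f : ι → ArithmeticFunction ℤ)
    (hf : ∀ n, ∀ᶠ i in cofinite, f i n = (1 : ArithmeticFunction ℤ) n) :
    ((eulerProduct f : ArithmeticFunction ℤ) : ArithmeticFunction ℂ) =
      eulerProduct fun i ↦ (f i : ArithmeticFunction ℂ) := by
  ext n
  obtain ⟨s, hs1, hs2⟩ := ((tendsTo_eulerProduct_of_tendsTo f hf n).and
    (tendsTo_eulerProduct_of_tendsTo _ (eventually_intCoe_apply_eq_one hf) n)).exists
  rw [intCoe_apply, ← hs1, ← hs2, ← intCoe_finset_prod, intCoe_apply]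

/-- A pointwise finite product of families converging to `1` coefficientwise converges to `1`
coefficientwise. [folklore] -/
private theorem eventually_finset_prod_apply_eq_one {R : Type*} [CommSemiring R] {α : Type*}
    (s : Finset α) (f : α → ι → ArithmeticFunction R)
    (hf : ∀ a ∈ s, ∀ n, ∀ᶠ i in cofinite, f a i n = (1 : ArithmeticFunction R) n) (n : ℕ) :
    ∀ᶠ i in cofinite, (∏ a ∈ s, f a i) n = (1 : ArithmeticFunction R) n := by
  have h : ∀ᶠ i in cofinite, ∀ a ∈ s, ∀ k ≤ n, f a i k = (1 : ArithmeticFunction R) k := by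
    rw [Finset.eventually_all]
    intro a ha
    have h' : ∀ k ∈ Finset.range (n + 1), ∀ᶠ i in cofinite,
        f a i k = (1 : ArithmeticFunction R) k := fun k _ ↦ hf a ha k
    rw [← Finset.eventually_all] at h'
    filter_upwards [h'] with i hi k hk
    exact hi k (Finset.mem_range.mpr (Nat.lt_succ_of_le hk))
  filter_upwards [h] with i hi
  exact finsetProd_apply_eq_one_apply_of_le s (fun a ↦ f a i) hi n le_rfl

/-- The Euler product of a pointwise finite product of families converging to `1` is the product
of the Euler products. [folklore] -/
private theorem eulerProduct_finset_prod {R : Type*} [CommSemiring R] {α : Type*} (s : Finset α)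
    (f : α → ι → ArithmeticFunction R)
    (hf : ∀ a ∈ s, ∀ n, ∀ᶠ i in cofinite, f a i n = (1 : ArithmeticFunction R) n) :
    eulerProduct (fun i ↦ ∏ a ∈ s, f a i) = ∏ a ∈ s, eulerProduct (f a) := by
  induction s using Finset.induction_on with
  | empty =>
    simp only [Finset.prod_empty]
    ext n
    obtain ⟨t, ht⟩ := (tendsTo_eulerProduct_of_tendsTo (fun _ : ι ↦ (1 : ArithmeticFunction R))
      (fun n ↦ Eventually.of_forall fun _ ↦ rfl) n).exists
    rw [← ht, Finset.prod_const_one]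
  | insert a s ha ih =>
    have hfa := hf a (Finset.mem_insert_self a s)
    have hfs : ∀ b ∈ s, ∀ n, ∀ᶠ i in cofinite, f b i n = (1 : ArithmeticFunction R) n :=
      fun b hb ↦ hf b (Finset.mem_insert_of_mem hb)
    simp only [Finset.prod_insert ha]
    rw [eulerProduct_mul_eq _ _ hfa (eventually_finset_prod_apply_eq_one s f hfs), ih hfs]

/-- A finitely supported Euler product is a finite product. [folklore] -/
private theorem eulerProduct_eq_finset_prod_of_eq_one {R : Type*} [CommSemiring R] (s : Finset ι)
    (f : ι → ArithmeticFunction R) (hf : ∀ i ∉ s, f i = 1) :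
    eulerProduct f = ∏ i ∈ s, f i := by
  have hconv : ∀ n, ∀ᶠ i in cofinite, f i n = (1 : ArithmeticFunction R) n := by
    intro n
    refine Filter.eventually_of_mem s.finite_toSet.compl_mem_cofinite fun i hi ↦ ?_
    rw [hf i (fun h ↦ hi (Finset.mem_coe.mpr h))]
  ext n
  obtain ⟨t, ht⟩ := eventually_atTop.mp (tendsTo_eulerProduct_of_tendsTo f hconv n)
  rw [← ht (t ∪ s) Finset.subset_union_left, ← Finset.prod_subset Finset.subset_union_right
    (fun i _ hi ↦ hf i hi)]

/-- The fibre products of a family converging to `1` coefficientwise, along a map with finite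
fibres, converge to `1` coefficientwise. [folklore] -/
private theorem eventually_finprod_fiber_apply_eq_one {κ R : Type*} [CommSemiring R]
    (f : ι → ArithmeticFunction R) (π : ι → κ) (hfib : ∀ k, {i | π i = k}.Finite)
    (hf : ∀ n, ∀ᶠ i in cofinite, f i n = (1 : ArithmeticFunction R) n) (n : ℕ) :
    ∀ᶠ k in cofinite, (∏ᶠ i ∈ {i | π i = k}, f i) n = (1 : ArithmeticFunction R) n := by
  have hB := finite_setOf_exists_apply_ne_one f hf n
  rw [eventually_cofinite]
  refine (hB.image π).subset fun k hk ↦ ?_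
  by_contra hk'
  apply hk
  rw [finprod_mem_eq_finite_toFinset_prod _ (hfib k)]
  refine finsetProd_apply_eq_one_apply_of_le _ _ (fun i hi j hj ↦ ?_) n le_rfl
  by_contra hij
  exact hk' ⟨i, ⟨j, hj, hij⟩, (hfib k).mem_toFinset.mp hi⟩

/-- A family that is `1` off a finite set converges to `1` coefficientwise. [folklore] -/
private theorem eventually_apply_eq_one_of_eq_one {R : Type*} [CommSemiring R] (s : Finset ι)
    (f : ι → ArithmeticFunction R) (hf : ∀ i ∉ s, f i = 1) (n : ℕ) :
    ∀ᶠ i in cofinite, f i n = (1 : ArithmeticFunction R) n := by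
  refine Filter.eventually_of_mem s.finite_toSet.compl_mem_cofinite fun i hi ↦ ?_
  rw [hf i (fun h ↦ hi (Finset.mem_coe.mpr h))]

end EulerProduct

/-! ### Twisting by a completely multiplicative function `ψ : ℕ → ℂ` -/

section Twist

open PowerSeries

variable (ψ : ℕ → ℂ)

/-- The twist `n ↦ ψ(n) f(n)` of an arithmetic function (Mathlib's pointwise product `pmul` with
`toArithmeticFunction ψ`): its values. [folklore] -/
theorem toArithmeticFunction_pmul_apply (f : ArithmeticFunction ℂ) (n : ℕ) :
    (toArithmeticFunction ψ).pmul f n = ψ n * f n := by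
  rw [pmul_apply]
  rcases Nat.eq_zero_or_pos n with rfl | hn
  · simp
  · simp [toArithmeticFunction, hn.ne']

variable (hψ1 : ψ 1 = 1) (hψ : ∀ a b : ℕ, ψ (a * b) = ψ a * ψ b)

include hψ1 in
/-- The twist of `1` by `ψ` with `ψ 1 = 1` is `1`. [folklore] -/
theorem toArithmeticFunction_pmul_one : (toArithmeticFunction ψ).pmul 1 = 1 := by
  ext n
  rw [toArithmeticFunction_pmul_apply, one_apply]
  split_ifs with h
  · subst h; rw [hψ1, mul_one]
  · rw [mul_zero]

include hψ1 in
/-- The twists by `ψ` (`ψ 1 = 1`) of a family converging to `1` coefficientwise converge to `1`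
coefficientwise. [folklore] -/
theorem eventually_toArithmeticFunction_pmul_apply_eq_one {ι : Type*}
    {f : ι → ArithmeticFunction ℂ} (hf : ∀ n, ∀ᶠ i in cofinite, f i n = (1 : ArithmeticFunction ℂ) n)
    (n : ℕ) :
    ∀ᶠ i in cofinite, (toArithmeticFunction ψ).pmul (f i) n = (1 : ArithmeticFunction ℂ) n := by
  filter_upwards [hf n] with i hi
  rw [toArithmeticFunction_pmul_apply, hi, ← toArithmeticFunction_pmul_apply ψ 1 n,
    toArithmeticFunction_pmul_one ψ hψ1]

include hψ in
/-- **Twisting by a completely multiplicative `ψ` is multiplicative on Dirichlet convolutions**: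
`ψ • (f * g) = (ψ • f) * (ψ • g)`. [folklore] -/
theorem toArithmeticFunction_pmul_mul (f g : ArithmeticFunction ℂ) :
    (toArithmeticFunction ψ).pmul (f * g) =
      (toArithmeticFunction ψ).pmul f * (toArithmeticFunction ψ).pmul g := by
  ext n
  rw [toArithmeticFunction_pmul_apply, mul_apply, mul_apply, Finset.mul_sum]
  refine Finset.sum_congr rfl fun x hx ↦ ?_
  rw [toArithmeticFunction_pmul_apply, toArithmeticFunction_pmul_apply]
  have hn : x.1 * x.2 = n := (Nat.mem_divisorsAntidiagonal.mp hx).1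
  rw [← hn, hψ]
  ring

include hψ1 hψ in
/-- Twisting a finite product by a completely multiplicative `ψ`. [folklore] -/
theorem toArithmeticFunction_pmul_finset_prod {α : Type*} (s : Finset α)
    (f : α → ArithmeticFunction ℂ) :
    (toArithmeticFunction ψ).pmul (∏ a ∈ s, f a) =
      ∏ a ∈ s, (toArithmeticFunction ψ).pmul (f a) := by
  induction s using Finset.induction_on with
  | empty => simp [toArithmeticFunction_pmul_one ψ hψ1]
  | insert a s ha ih =>
    rw [Finset.prod_insert ha, Finset.prod_insert ha, toArithmeticFunction_pmul_mul ψ hψ, ih]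

include hψ1 hψ in
/-- **Twisting by a completely multiplicative `ψ` commutes with Euler products** (it acts
coefficientwise). [folklore] -/
theorem toArithmeticFunction_pmul_eulerProduct {ι : Type*} (f : ι → ArithmeticFunction ℂ)
    (hf : ∀ n, ∀ᶠ i in cofinite, f i n = (1 : ArithmeticFunction ℂ) n) :
    (toArithmeticFunction ψ).pmul (eulerProduct f) =
      eulerProduct fun i ↦ (toArithmeticFunction ψ).pmul (f i) := by
  have hf' := eventually_toArithmeticFunction_pmul_apply_eq_one ψ hψ1 hf
  ext n
  obtain ⟨s, hs1, hs2⟩ := ((tendsTo_eulerProduct_of_tendsTo f hf n).and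
    (tendsTo_eulerProduct_of_tendsTo _ hf' n)).exists
  rw [toArithmeticFunction_pmul_apply, ← hs1, ← hs2,
    ← toArithmeticFunction_pmul_finset_prod ψ hψ1 hψ, toArithmeticFunction_pmul_apply]

include hψ1 hψ in
/-- **Twisting a local factor rescales it**: for `q > 1` and `ψ` completely multiplicative,
`ψ • f(q⁻ˢ) = (rescale (ψ q) f)(q⁻ˢ)` (the coefficient of `q^{-ks}` is multiplied by
`ψ(q^k) = ψ(q)^k`). [folklore] -/
theorem toArithmeticFunction_pmul_ofPowerSeries {q : ℕ} (hq : 1 < q) (φ : PowerSeries ℂ) :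
    (toArithmeticFunction ψ).pmul (ofPowerSeries q φ) = ofPowerSeries q (rescale (ψ q) φ) := by
  have hpow : ∀ k : ℕ, ψ (q ^ k) = ψ q ^ k := fun k ↦ by
    induction k with
    | zero => rw [pow_zero, pow_zero, hψ1]
    | succ k ih => rw [pow_succ, hψ, ih, pow_succ]
  ext n
  rw [toArithmeticFunction_pmul_apply]
  by_cases hn : ∃ k, q ^ k = n
  · obtain ⟨k, rfl⟩ := hn
    rw [ofPowerSeries_apply_pow hq, ofPowerSeries_apply_pow hq, coeff_rescale, hpow]
  · rw [ofPowerSeries_apply hq, ofPowerSeries_apply hq, Function.extend_apply' _ _ _ hn,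
      Function.extend_apply' _ _ _ hn, Pi.zero_apply, mul_zero]

/-- Coercion `ℤ → ℂ` of `ofPowerSeries` (`q > 1`). [folklore] -/
private theorem intCoe_ofPowerSeries {q : ℕ} (hq : 1 < q) (φ : PowerSeries ℤ) :
    ((ofPowerSeries q φ : ArithmeticFunction ℤ) : ArithmeticFunction ℂ) =
      ofPowerSeries q (φ.map (Int.castRingHom ℂ)) := by
  ext n
  rw [intCoe_apply]
  by_cases hn : ∃ k, q ^ k = n
  · obtain ⟨k, rfl⟩ := hn
    rw [ofPowerSeries_apply_pow hq, ofPowerSeries_apply_pow hq, PowerSeries.coeff_map, eq_intCast]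
  · rw [ofPowerSeries_apply hq, ofPowerSeries_apply hq, Function.extend_apply' _ _ _ hn,
      Function.extend_apply' _ _ _ hn, Pi.zero_apply, Pi.zero_apply, Int.cast_zero]

end Twist

end ArithmeticFunction

/-! ## Power series: `invOfUnit · 1` versus `map`, `rescale`, products and powers -/

namespace PowerSeries

/-- `map` commutes with `invOfUnit · 1` for power series of constant coefficient `1`. [folklore] -/
private theorem map_invOfUnit_one {R S : Type*} [CommRing R] [CommRing S] (f : R →+* S)
    {φ : PowerSeries R} (hφ : constantCoeff φ = 1) :
    (invOfUnit φ 1).map f = invOfUnit (φ.map f) 1 := by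
  symm
  refine invOfUnit_one_eq_of_mul_eq_one
    (by rw [← coeff_zero_eq_constantCoeff, PowerSeries.coeff_map, coeff_zero_eq_constantCoeff, hφ,
      map_one]) ?_
  rw [← map_mul, mul_invOfUnit φ 1 (by rw [hφ, Units.val_one]), map_one]

/-- `rescale` commutes with `invOfUnit · 1` for power series of constant coefficient `1`.
[folklore] -/
private theorem rescale_invOfUnit_one {R : Type*} [CommRing R] (c : R) {φ : PowerSeries R}
    (hφ : constantCoeff φ = 1) : rescale c (invOfUnit φ 1) = invOfUnit (rescale c φ) 1 := by
  symm
  refine invOfUnit_one_eq_of_mul_eq_one ?_ ?_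
  · rw [← coeff_zero_eq_constantCoeff, coeff_rescale, pow_zero, one_mul,
      coeff_zero_eq_constantCoeff, hφ]
  · rw [← map_mul, mul_invOfUnit φ 1 (by rw [hφ, Units.val_one]), map_one]

/-- `invOfUnit · 1` of a finite product of power series of constant coefficient `1`. [folklore] -/
private theorem invOfUnit_one_finset_prod {R : Type*} [CommRing R] {α : Type*} (s : Finset α)
    (φ : α → PowerSeries R) (hφ : ∀ a ∈ s, constantCoeff (φ a) = 1) :
    invOfUnit (∏ a ∈ s, φ a) 1 = ∏ a ∈ s, invOfUnit (φ a) 1 := by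
  induction s using Finset.induction_on with
  | empty =>
    simp only [Finset.prod_empty]
    exact invOfUnit_one_eq_of_mul_eq_one (map_one _) (mul_one 1)
  | insert a s ha ih =>
    have ha1 := hφ a (Finset.mem_insert_self a s)
    have hs1 : ∀ b ∈ s, constantCoeff (φ b) = 1 := fun b hb ↦ hφ b (Finset.mem_insert_of_mem hb)
    have hprod : constantCoeff (∏ b ∈ s, φ b) = 1 := by
      rw [map_prod]
      exact Finset.prod_eq_one hs1
    rw [Finset.prod_insert ha, Finset.prod_insert ha,
      invOfUnit_mul_of_constantCoeff_eq_one ha1 hprod, ih hs1]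

/-- `invOfUnit · 1` of a power of a power series of constant coefficient `1`. [folklore] -/
private theorem invOfUnit_one_pow {R : Type*} [CommRing R] (φ : PowerSeries R)
    (hφ : constantCoeff φ = 1) (g : ℕ) : invOfUnit (φ ^ g) 1 = (invOfUnit φ 1) ^ g := by
  have h := invOfUnit_one_finset_prod (Finset.range g) (fun _ ↦ φ) fun _ _ ↦ hφ
  rwa [Finset.prod_const, Finset.card_range, Finset.prod_const, Finset.card_range] at h

end PowerSeries

namespace WeierstrassCurve

open ArithmeticFunction Literature.NumberTheory.EllipticCurves
  Literature.NumberTheory.GaloisRepresentations Literature.NumberTheory.NumberFields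
  Literature.NumberTheory.LFunctions.AbelianSplitting
  Literature.NumberTheory.LFunctions.AbelianDedekindZeta IsCyclotomicExtension.Rat

/-! ## Places of `ℚ` and the places above them -/

section Places

/-- **The residue cardinality of a finite place of `ℚ` is the prime below it**: `N v` is prime and
lies in `v`. [folklore] -/
private theorem residueCard_rat (v : HeightOneSpectrum (𝓞 ℚ)) :
    v.residueCard.Prime ∧ (v.residueCard : 𝓞 ℚ) ∈ v.asIdeal := by
  refine ⟨?_, by exact_mod_cast Ideal.absNorm_mem v.asIdeal⟩
  rw [v.residueCard_eq_card_quotient]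
  have h : Ideal.span {(Rat.HeightOneSpectrum.natGenerator v : ℤ)} =
      v.asIdeal.map (Rat.IsIntegralClosure.intEquiv (𝓞 ℚ) : 𝓞 ℚ →+* ℤ) :=
    Rat.HeightOneSpectrum.span_natGenerator v
  rw [Nat.card_congr ((Ideal.quotientEquiv _ _ (Rat.IsIntegralClosure.intEquiv (𝓞 ℚ)) h).trans
    (Int.quotientSpanNatEquivZMod _)).toEquiv, Nat.card_zmod]
  exact Rat.HeightOneSpectrum.prime_natGenerator v

/-- `v ∩ ℤ = (N v)` for a finite place `v` of `ℚ`. [folklore] -/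
private theorem under_int_eq_span_residueCard (v : HeightOneSpectrum (𝓞 ℚ)) :
    v.asIdeal.under ℤ = Ideal.span {(v.residueCard : ℤ)} := by
  obtain ⟨hp, hpv⟩ := residueCard_rat v
  haveI : Fact v.residueCard.Prime := ⟨hp⟩
  refine ((Int.ideal_span_isMaximal_of_prime v.residueCard).eq_of_le
    (Ideal.comap_ne_top _ v.isPrime.ne_top) ?_).symm
  rw [Ideal.span_le, Set.singleton_subset_iff, SetLike.mem_coe]
  exact Ideal.mem_comap.mpr (by rw [map_natCast]; exact hpv)

/-- An ideal of `𝓞 ℚ` is determined by its contraction to `ℤ` (`ℤ → 𝓞 ℚ` is onto). [folklore] -/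
private theorem eq_of_under_int_eq {I J : Ideal (𝓞 ℚ)} (h : I.under ℤ = J.under ℤ) : I = J := by
  have hsurj := Rat.int_algebraMap_surjective (𝓞 ℚ)
  calc I = (I.under ℤ).map (algebraMap ℤ (𝓞 ℚ)) := (Ideal.map_comap_of_surjective _ hsurj _).symm
    _ = (J.under ℤ).map (algebraMap ℤ (𝓞 ℚ)) := by rw [h]
    _ = J := Ideal.map_comap_of_surjective _ hsurj _

variable {M : Type*} [Field M] [NumberField M]

/-- A place `w` of `M` above the place `v` of `ℚ` has `w ∩ ℤ = (N v)`. [folklore] -/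
private theorem under_int_eq_span_residueCard_of_under_eq {v : HeightOneSpectrum (𝓞 ℚ)}
    {w : HeightOneSpectrum (𝓞 M)} (hw : w.asIdeal.under (𝓞 ℚ) = v.asIdeal) :
    w.asIdeal.under ℤ = Ideal.span {(v.residueCard : ℤ)} := by
  rw [← under_int_eq_span_residueCard v, ← hw, Ideal.under_under]

/-- **Residue degrees over `ℤ` and over `𝓞 ℚ` agree**: `f(w|ℤ) = f(v|ℤ) f(w|v)` with
`f(v|ℤ) = 1` (`N v = p`). [folklore] -/
private theorem inertiaDeg_int_eq {v : HeightOneSpectrum (𝓞 ℚ)} {w : HeightOneSpectrum (𝓞 M)}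
    (hw : w.asIdeal.under (𝓞 ℚ) = v.asIdeal) :
    w.asIdeal.inertiaDeg ℤ = w.asIdeal.inertiaDeg (𝓞 ℚ) := by
  obtain ⟨hp, -⟩ := residueCard_rat v
  haveI : Fact v.residueCard.Prime := ⟨hp⟩
  haveI := v.isMaximal
  haveI : v.asIdeal.LiesOver (Ideal.span {(v.residueCard : ℤ)}) :=
    ⟨(under_int_eq_span_residueCard v).symm⟩
  haveI : w.asIdeal.LiesOver v.asIdeal := ⟨hw.symm⟩
  have htower := Ideal.inertiaDeg_tower v.asIdeal w.asIdeal (R := ℤ)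
  have hv1 : v.asIdeal.inertiaDeg ℤ = 1 := by
    have h := Ideal.absNorm_eq_pow_inertiaDeg' v.asIdeal hp
    rw [Ideal.inertiaDeg'_eq_inertiaDeg] at h
    have h' : v.residueCard ^ 1 = v.residueCard ^ v.asIdeal.inertiaDeg ℤ := by
      rw [pow_one]; exact h
    exact (Nat.pow_right_injective hp.two_le h').symm
  rw [hv1, one_mul] at htower
  exact htower

/-- **The number of places of `M` above `v` is the length of the splitting type of `p = N v`**
(the places above `v` are the distinct prime factors of `p 𝓞 M`, `mem_normalizedFactors_span_iff`).
[folklore] -/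
private theorem card_toFinset_setOf_under_eq (v : HeightOneSpectrum (𝓞 ℚ))
    (hT : {w : HeightOneSpectrum (𝓞 M) | w.under (𝓞 ℚ) = v}.Finite) :
    hT.toFinset.card = Multiset.card (splittingType M v.residueCard) := by
  obtain ⟨hp, -⟩ := residueCard_rat v
  rw [splittingType, Multiset.card_map, ← Multiset.card_toFinset]
  have hmem : ∀ P : Ideal (𝓞 M),
      P ∈ (UniqueFactorizationMonoid.normalizedFactors
        (Ideal.span {(v.residueCard : 𝓞 M)})).toFinset ↔
      P.IsPrime ∧ P.LiesOver (Ideal.span {(v.residueCard : ℤ)}) := fun P ↦ by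
    rw [Multiset.mem_toFinset, mem_normalizedFactors_span_iff hp]
  refine Finset.card_nbij (fun w ↦ w.asIdeal) ?_ ?_ ?_
  · intro w hw
    have hw' : w.asIdeal.under (𝓞 ℚ) = v.asIdeal :=
      congrArg HeightOneSpectrum.asIdeal (hT.mem_toFinset.mp (Finset.mem_coe.mp hw))
    exact Finset.mem_coe.mpr ((hmem _).mpr
      ⟨w.isPrime, ⟨(under_int_eq_span_residueCard_of_under_eq hw').symm⟩⟩)
  · intro w₁ _ w₂ _ h
    exact HeightOneSpectrum.ext h
  · intro P hP
    obtain ⟨hPp, hover⟩ := (hmem P).mp (Finset.mem_coe.mp hP)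
    have hne : P ≠ ⊥ := ne_bot_of_mem_normalizedFactors_span hp
      (Multiset.mem_toFinset.mp (Finset.mem_coe.mp hP))
    refine ⟨⟨P, hPp, hne⟩, Finset.mem_coe.mpr (hT.mem_toFinset.mpr ?_), rfl⟩
    refine HeightOneSpectrum.ext (eq_of_under_int_eq ?_)
    rw [under_int_eq_span_residueCard v]
    change (P.under (𝓞 ℚ)).under ℤ = _
    rw [Ideal.under_under]
    exact hover.over.symm

end Places

/-! ## Local Euler factors: generalities -/

section LocalFactors

variable {K : Type*} [Field K] [NumberField K] (X' : WeierstrassCurve K)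

/-- At any finite place `w`, the local Euler factor times the local polynomial (both as Dirichlet
series in `N w^{-s}`) is `1`. [folklore] -/
private theorem localEulerFactor_mul_ofPowerSeries (w : HeightOneSpectrum (𝓞 K)) :
    (X'.baseChange (w.adicCompletion K)).localEulerFactor (w.adicCompletionIntegers K) *
      ofPowerSeries w.residueCard ((X'.localPolynomialAt w : ℤ[X]) : PowerSeries ℤ) = 1 := by
  rw [X'.localEulerFactor_baseChange_adicCompletion w, ← map_mul, mul_comm,
    PowerSeries.mul_invOfUnit _ 1 (by rw [Polynomial.constantCoeff_coe,
      X'.coeff_zero_localPolynomialAt w, Units.val_one]), map_one]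

/-- Over a finite set `T` of places, `∏_{w ∈ T} L_w(N w^{-s})⁻¹ · ∏_{w ∈ T} L_w(N w^{-s}) = 1`.
[folklore] -/
private theorem finprod_localEulerFactor_mul_finprod_ofPowerSeries
    {T : Set (HeightOneSpectrum (𝓞 K))} (hT : T.Finite) :
    (∏ᶠ w ∈ T, (X'.baseChange (w.adicCompletion K)).localEulerFactor
        (w.adicCompletionIntegers K)) *
      ∏ᶠ w ∈ T, ofPowerSeries w.residueCard ((X'.localPolynomialAt w : ℤ[X]) : PowerSeries ℤ) =
      1 := by
  rw [← finprod_mem_mul_distrib hT]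
  exact finprod_mem_of_eqOn_one fun w _ ↦ X'.localEulerFactor_mul_ofPowerSeries w

end LocalFactors

/-! ## Twists by primitive Dirichlet characters -/

section PrimitiveTwist

variable {m : ℕ} (χ : DirichletCharacter ℂ m)

/-- `χ⋆(1) = 1`. [folklore] -/
private theorem primitive_map_one :
    (fun k : ℕ ↦ χ.primitiveCharacter (k : ZMod χ.conductor)) 1 = 1 := by
  simp only [Nat.cast_one, map_one]

/-- `χ⋆` is completely multiplicative on `ℕ`. [folklore] -/
private theorem primitive_map_mul (a b : ℕ) :
    (fun k : ℕ ↦ χ.primitiveCharacter (k : ZMod χ.conductor)) (a * b) =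
      (fun k : ℕ ↦ χ.primitiveCharacter (k : ZMod χ.conductor)) a *
        (fun k : ℕ ↦ χ.primitiveCharacter (k : ZMod χ.conductor)) b := by
  simp only [Nat.cast_mul, map_mul]

/-- The twist by `χ⋆` of `1` is `1`. [folklore] -/
private theorem primitiveTwist_one :
    (toArithmeticFunction fun k : ℕ ↦ χ.primitiveCharacter (k : ZMod χ.conductor)).pmul 1 = 1 :=
  toArithmeticFunction_pmul_one _ (primitive_map_one χ)

/-- The twist by `χ⋆` commutes with Euler products. [folklore] -/
private theorem primitiveTwist_eulerProduct {ι : Type*} (f : ι → ArithmeticFunction ℂ)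
    (hf : ∀ n, ∀ᶠ i in cofinite, f i n = (1 : ArithmeticFunction ℂ) n) :
    (toArithmeticFunction fun k : ℕ ↦ χ.primitiveCharacter (k : ZMod χ.conductor)).pmul
        (eulerProduct f) =
      eulerProduct fun i ↦
        (toArithmeticFunction fun k : ℕ ↦ χ.primitiveCharacter (k : ZMod χ.conductor)).pmul
          (f i) :=
  toArithmeticFunction_pmul_eulerProduct _ (primitive_map_one χ) (primitive_map_mul χ) f hf

/-- The twist by `χ⋆` of a local factor at `q` rescales it by `χ⋆(q)`. [folklore] -/
private theorem primitiveTwist_ofPowerSeries {q : ℕ} (hq : 1 < q) (φ : PowerSeries ℂ) :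
    (toArithmeticFunction fun k : ℕ ↦ χ.primitiveCharacter (k : ZMod χ.conductor)).pmul
        (ofPowerSeries q φ) =
      ofPowerSeries q (PowerSeries.rescale (χ.primitiveCharacter (q : ZMod χ.conductor)) φ) :=
  toArithmeticFunction_pmul_ofPowerSeries _ (primitive_map_one χ) (primitive_map_mul χ) hq φ

/-- The twists by `χ⋆` of a family converging to `1` coefficientwise converge to `1`
coefficientwise. [folklore] -/
private theorem eventually_primitiveTwist_apply_eq_one {ι : Type*}
    {f : ι → ArithmeticFunction ℂ} (hf : ∀ n, ∀ᶠ i in cofinite, f i n = (1 : ArithmeticFunction ℂ) n)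
    (n : ℕ) :
    ∀ᶠ i in cofinite,
      (toArithmeticFunction fun k : ℕ ↦ χ.primitiveCharacter (k : ZMod χ.conductor)).pmul (f i) n =
        (1 : ArithmeticFunction ℂ) n :=
  eventually_toArithmeticFunction_pmul_apply_eq_one _ (primitive_map_one χ) hf n

end PrimitiveTwist

/-! ## The local Artin identity at a place of semistable reduction -/

section LocalIdentity

variable (W : WeierstrassCurve ℚ) [W.IsElliptic] {m : ℕ} [NeZero m] (L : Type) [Field L]
  [NumberField L] [hL : IsCyclotomicExtension {m} ℚ L] (F : IntermediateField ℚ L)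

/-- Over `ℂ` every pair (sum, product) is realised: `∃ α β, α + β = t ∧ αβ = δ`. [folklore] -/
private theorem exists_add_eq_and_mul_eq (t δ : ℂ) : ∃ α β : ℂ, α + β = t ∧ α * β = δ := by
  obtain ⟨s, hs⟩ := IsAlgClosed.exists_pow_nat_eq (t ^ 2 - 4 * δ) two_pos
  exact ⟨(t + s) / 2, (t - s) / 2, by ring, by linear_combination (-1 / 4 : ℂ) * hs⟩

/-- The rescaling of `(1 - αX)(1 - βX)` by `c` is `(1 - αcX)(1 - βcX)` (as power series).
[folklore] -/
private theorem rescale_coe_one_sub_mul (α β c : ℂ) :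
    PowerSeries.rescale c (((1 - C α * X) * (1 - C β * X) : ℂ[X]) : PowerSeries ℂ) =
      (((1 - C (α * c) * X) * (1 - C (β * c) * X) : ℂ[X]) : PowerSeries ℂ) := by
  ext k
  rw [PowerSeries.coeff_rescale, Polynomial.coeff_coe, Polynomial.coeff_coe]
  have h1 : ((1 - C α * X) * (1 - C β * X) : ℂ[X]) = 1 - C (α + β) * X + C (α * β) * X ^ 2 := by
    rw [C_add, C_mul]; ring
  have h2 : ((1 - C (α * c) * X) * (1 - C (β * c) * X) : ℂ[X]) =
      1 - C ((α + β) * c) * X + C (α * β * c ^ 2) * X ^ 2 := by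
    simp only [C_mul, C_add, C_pow]; ring
  rw [h1, h2]
  simp only [coeff_add, coeff_sub, coeff_one, coeff_C_mul, coeff_X_pow, coeff_X]
  rcases k with _ | _ | _ | k
  · simp
  · simp; ring
  · simp; ring
  · simp

include hL in
set_option maxHeartbeats 1600000 in
/-- **The local Artin identity at a place of semistable reduction** (ramified in `F` or not).
Let `L ⊇ ℚ` be an `m`-th cyclotomic field, `F ⊆ L` with character group
`X(F) = {χ mod m : χ(a_σ) = 1 ∀ σ ∈ Gal(L/F)}`, `E/ℚ` an elliptic curve and `v` a finite place of
`ℚ` (`p = N v`) at which `E` is semistable.  Then the product over the places `w ∣ v` of `F` of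
the local Euler factors of `E_F` is the product over `χ ∈ X(F)` of the twists by the primitive
characters `χ⋆` of the local Euler factor of `E` at `v`:
`∏_{w ∣ v} L_w(E_F, N w^{-s})⁻¹ = ∏_{χ ∈ X(F)} L_v(E, χ⋆(p) p^{-s})⁻¹`.  Proof: all `w ∣ v` have
residue degree `f₀ = ord(φ mod HI)` and `L_w(E_F, T) = (1 - α^{f₀}T)(1 - β^{f₀}T)` where
`L_v(E, T) = (1 - αT)(1 - βT)` (`map_localPolynomialAt_baseChange_eq_of_isSemistableAt`), there
are `g` of them with `g f₀ = [G : HI]` (`card_splittingType_mul_orderOf`), `N w = p^{f₀}`, and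
`∏_{χ ∈ X(F)} (1 - χ⋆(p) γ y) = (1 - (γ y)^{f₀})^{[G : HI⟨φ⟩]}`, `γ = α, β`
(`prod_characterGroup_one_sub_primitive_mul`) with `f₀ [G : HI⟨φ⟩] = [G : HI]`.  This is Artin
formalism `L(E/F, s) = ∏_χ L(E ⊗ χ, s)` one semistable prime at a time (Ireland–Rosen
Prop. 20.5.4 (b) for `[F : ℚ] = 2`). [cite: IrelandRosen1990, Ch. 20 §5, Prop. 20.5.4(b) (PDF p. 353)] -/
theorem intCoe_finprod_localEulerFactor_baseChange_eq_prod_primitiveTwist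
    (v : HeightOneSpectrum (𝓞 ℚ)) (hv : W.IsSemistableAt v) :
    ((∏ᶠ w ∈ {w : HeightOneSpectrum (𝓞 F) | w.under (𝓞 ℚ) = v},
        (((W.baseChange F).baseChange (w.adicCompletion F)).localEulerFactor
          (w.adicCompletionIntegers F) : ArithmeticFunction ℤ) : ArithmeticFunction ℤ) :
        ArithmeticFunction ℂ) =
      ∏ χ ∈ ({χ | ∀ σ ∈ F.fixingSubgroup, χ (galEquivZMod m L σ) = 1} :
          Finset (DirichletCharacter ℂ m)),
        (toArithmeticFunction fun k : ℕ ↦ χ.primitiveCharacter (k : ZMod χ.conductor)).pmul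
          (((W.baseChange (v.adicCompletion ℚ)).localEulerFactor (v.adicCompletionIntegers ℚ) :
            ArithmeticFunction ℤ) : ArithmeticFunction ℂ) := by
  -- the prime `p = N v` below `v`
  obtain ⟨hp, hpv⟩ := residueCard_rat v
  haveI : Fact v.residueCard.Prime := ⟨hp⟩
  have hp1 : 1 < v.residueCard := hp.one_lt
  -- Galois data: `G` abelian, a prime `Q₀ ∣ p` of `L` and a Frobenius `φ` at `Q₀`
  haveI : IsAbelianGalois ℚ L := IsCyclotomicExtension.isAbelianGalois {m} ℚ L
  haveI : IsMulCommutative (L ≃ₐ[ℚ] L) := IsAbelianGalois.toIsMulCommutative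
  have hp𝔭 : Ideal.span {(v.residueCard : ℤ)} ≠ ⊥ := by
    rw [Ne, Ideal.span_singleton_eq_bot]
    exact_mod_cast hp.ne_zero
  haveI : IsGaloisGroup (L ≃ₐ[ℚ] L) ℤ (𝓞 L) := IsGaloisGroup.of_isFractionRing _ _ _ ℚ L
  obtain ⟨Q₀, hQ₀max, hQ₀over⟩ :=
    Ideal.exists_maximal_ideal_liesOver_of_isIntegral (S := 𝓞 L)
      (Ideal.span {(v.residueCard : ℤ)})
  haveI := hQ₀max
  haveI := hQ₀over
  haveI : Finite (𝓞 L ⧸ Q₀) :=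
    Ideal.finiteQuotientOfFreeOfNeBot Q₀ (Ideal.ne_bot_of_liesOver_of_ne_bot hp𝔭 Q₀)
  obtain ⟨φ, hφ⟩ := IsArithFrobAt.exists_of_isInvariant ℤ (L ≃ₐ[ℚ] L) Q₀
  set f₀ := orderOf (QuotientGroup.mk φ :
    (L ≃ₐ[ℚ] L) ⧸ (F.fixingSubgroup ⊔ Q₀.inertia (L ≃ₐ[ℚ] L))) with hf₀
  have hf0 : 0 < f₀ := orderOf_pos _
  -- the places above `v`: `g` of them, `g f₀ = [G : HI] = f₀ [G : HI⟨φ⟩]`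
  have hT : {w : HeightOneSpectrum (𝓞 F) | w.under (𝓞 ℚ) = v}.Finite :=
    v.finite_setOf_under_eq_of_numberField
  have hg : hT.toFinset.card =
      (F.fixingSubgroup ⊔ Q₀.inertia (L ≃ₐ[ℚ] L) ⊔ Subgroup.zpowers φ).index := by
    have h1 := card_splittingType_mul_orderOf F hp Q₀ hφ
    have h2 := orderOf_mk_mul_index_sup' (F.fixingSubgroup ⊔ Q₀.inertia (L ≃ₐ[ℚ] L)) φ
    rw [← card_toFinset_setOf_under_eq v hT, ← h2, mul_comm] at h1
    exact Nat.eq_of_mul_eq_mul_left hf0 h1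
  -- the local polynomial at `v` over `ℂ`: `(1 - αT)(1 - βT)`
  obtain ⟨t, δ, htδ⟩ := exists_localPolynomial_eq_quadratic (v.adicCompletionIntegers ℚ)
    (W.baseChange (v.adicCompletion ℚ))
  have hLv : W.localPolynomialAt v = 1 - C t * X + C δ * X ^ 2 := htδ
  obtain ⟨α, β, h1, h2⟩ := exists_add_eq_and_mul_eq (t : ℂ) (δ : ℂ)
  have hLvC : (W.localPolynomialAt v).map (Int.castRingHom ℂ) = (1 - C α * X) * (1 - C β * X) := by
    rw [hLv]
    have h' : ((1 - C t * X + C δ * X ^ 2 : ℤ[X]).map (Int.castRingHom ℂ)) =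
        (1 - C (t : ℂ) * X + C (δ : ℂ) * X ^ 2 : ℂ[X]) := by
      simp [Polynomial.map_sub, Polynomial.map_mul]
    rw [h', ← h1, ← h2, C_add, C_mul]
    ring
  have hLvC1 : PowerSeries.constantCoeff
      (((W.localPolynomialAt v).map (Int.castRingHom ℂ) : ℂ[X]) : PowerSeries ℂ) = 1 := by
    rw [Polynomial.constantCoeff_coe, Polynomial.coeff_map, W.coeff_zero_localPolynomialAt v,
      map_one]
  -- every `w ∣ v` has residue degree `f₀` and `L_w(E_F) = (1 - α^{f₀}X)(1 - β^{f₀}X)` over `ℂ`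
  set Lf : ℂ[X] := (1 - C (α ^ f₀) * X) * (1 - C (β ^ f₀) * X) with hLf
  have hw : ∀ w : HeightOneSpectrum (𝓞 F), w.asIdeal.under (𝓞 ℚ) = v.asIdeal →
      w.asIdeal.inertiaDeg (𝓞 ℚ) = f₀ ∧
      ((W.baseChange F).localPolynomialAt w).map (Int.castRingHom ℂ) = Lf := by
    intro w hw'
    have hfw : w.asIdeal.inertiaDeg (𝓞 ℚ) = f₀ := by
      rw [← inertiaDeg_int_eq hw']
      haveI := w.isPrime
      haveI : w.asIdeal.LiesOver (Ideal.span {(v.residueCard : ℤ)}) :=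
        ⟨(under_int_eq_span_residueCard_of_under_eq hw').symm⟩
      refine eq_orderOf_of_mem_splittingType F hp Q₀ hφ ?_
      rw [splittingType, Multiset.mem_map]
      exact ⟨w.asIdeal, Multiset.mem_dedup.mpr ((mem_normalizedFactors_span_iff hp).mpr
        ⟨w.isPrime, inferInstance⟩), rfl⟩
    refine ⟨hfw, ?_⟩
    rw [W.map_localPolynomialAt_baseChange_eq_of_isSemistableAt F hw' hv hLvC, hfw]
  /- ### Left-hand side: `g` equal factors -/
  set A₀ : ArithmeticFunction ℂ := ofPowerSeries v.residueCard
    (PowerSeries.invOfUnit ((expand ℂ f₀ Lf : ℂ[X]) : PowerSeries ℂ) 1) with hA₀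
  have hexp0 : PowerSeries.constantCoeff ((expand ℂ f₀ Lf : ℂ[X]) : PowerSeries ℂ) = 1 := by
    rw [Polynomial.constantCoeff_coe, Polynomial.coeff_expand hf0, if_pos (dvd_zero f₀),
      Nat.zero_div, hLf]
    simp
  have hfac : ∀ w ∈ hT.toFinset,
      ((((W.baseChange F).baseChange (w.adicCompletion F)).localEulerFactor
        (w.adicCompletionIntegers F) : ArithmeticFunction ℤ) : ArithmeticFunction ℂ) = A₀ := by
    intro w hwT
    have hw' : w.asIdeal.under (𝓞 ℚ) = v.asIdeal :=
      congrArg HeightOneSpectrum.asIdeal (hT.mem_toFinset.mp hwT)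
    obtain ⟨hfw, hLw⟩ := hw w hw'
    have hL0 : ((W.baseChange F).localPolynomialAt w).coeff 0 = 1 :=
      (W.baseChange F).coeff_zero_localPolynomialAt w
    rw [(W.baseChange F).localEulerFactor_baseChange_adicCompletion w,
      residueCard_eq_residueCard_pow_inertiaDeg hw', hfw, ofPowerSeries_pow _ hf0.ne',
      PowerSeries.subst_X_pow_invOfUnit_coe hf0.ne' _ hL0, intCoe_ofPowerSeries hp1,
      PowerSeries.map_invOfUnit_one _ (by
        rw [Polynomial.constantCoeff_coe, Polynomial.coeff_expand hf0, if_pos (dvd_zero f₀),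
          Nat.zero_div, hL0]),
      ← Polynomial.polynomial_map_coe, Polynomial.map_expand, hLw]
  have hLHS : ((∏ᶠ w ∈ {w : HeightOneSpectrum (𝓞 F) | w.under (𝓞 ℚ) = v},
      (((W.baseChange F).baseChange (w.adicCompletion F)).localEulerFactor
        (w.adicCompletionIntegers F) : ArithmeticFunction ℤ) : ArithmeticFunction ℤ) :
        ArithmeticFunction ℂ) = A₀ ^ hT.toFinset.card := by
    rw [finprod_mem_eq_finite_toFinset_prod _ hT, intCoe_finset_prod,
      Finset.prod_congr rfl hfac, Finset.prod_const]
  /- ### Right-hand side: the twists rescale `L_v(E, T)⁻¹` -/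
  have hRHS : ∀ χ : DirichletCharacter ℂ m,
      (toArithmeticFunction fun k : ℕ ↦ χ.primitiveCharacter (k : ZMod χ.conductor)).pmul
        (((W.baseChange (v.adicCompletion ℚ)).localEulerFactor (v.adicCompletionIntegers ℚ) :
          ArithmeticFunction ℤ) : ArithmeticFunction ℂ) =
      ofPowerSeries v.residueCard (PowerSeries.invOfUnit
        (((1 - C (α * χ.primitiveCharacter (v.residueCard : ZMod χ.conductor)) * X) *
          (1 - C (β * χ.primitiveCharacter (v.residueCard : ZMod χ.conductor)) * X) : ℂ[X]) :
            PowerSeries ℂ) 1) := by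
    intro χ
    rw [W.localEulerFactor_baseChange_adicCompletion v, intCoe_ofPowerSeries hp1,
      PowerSeries.map_invOfUnit_one _ (by
        rw [Polynomial.constantCoeff_coe, W.coeff_zero_localPolynomialAt v]),
      ← Polynomial.polynomial_map_coe, primitiveTwist_ofPowerSeries χ hp1,
      PowerSeries.rescale_invOfUnit_one _ hLvC1, hLvC, rescale_coe_one_sub_mul]
  /- ### The polynomial identity -/
  have hpoly : (expand ℂ f₀ Lf) ^ hT.toFinset.card =
      ∏ χ ∈ ({χ | ∀ σ ∈ F.fixingSubgroup, χ (galEquivZMod m L σ) = 1} :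
          Finset (DirichletCharacter ℂ m)),
        ((1 - C (α * χ.primitiveCharacter (v.residueCard : ZMod χ.conductor)) * X) *
          (1 - C (β * χ.primitiveCharacter (v.residueCard : ZMod χ.conductor)) * X) : ℂ[X]) := by
    refine Polynomial.funext fun y ↦ ?_
    rw [eval_pow, expand_eval, eval_prod]
    have hfacχ : ∀ χ : DirichletCharacter ℂ m,
        eval y (((1 - C (α * χ.primitiveCharacter (v.residueCard : ZMod χ.conductor)) * X) *
          (1 - C (β * χ.primitiveCharacter (v.residueCard : ZMod χ.conductor)) * X) : ℂ[X])) =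
        (1 - χ.primitiveCharacter (v.residueCard : ZMod χ.conductor) * (α * y)) *
          (1 - χ.primitiveCharacter (v.residueCard : ZMod χ.conductor) * (β * y)) := by
      intro χ
      simp only [eval_mul, eval_sub, eval_one, eval_C, eval_X]
      ring
    simp_rw [hfacχ]
    rw [Finset.prod_mul_distrib, prod_characterGroup_one_sub_primitive_mul L F Q₀ hφ (α * y),
      prod_characterGroup_one_sub_primitive_mul L F Q₀ hφ (β * y), ← hf₀, ← hg, ← mul_pow]
    congr 1
    rw [hLf]
    simp only [eval_mul, eval_sub, eval_one, eval_C, eval_X]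
    ring
  /- ### Assembly -/
  rw [hLHS, Finset.prod_congr rfl fun χ _ ↦ hRHS χ, ← map_prod,
    ← PowerSeries.invOfUnit_one_finset_prod _ _ (fun χ _ ↦ by
      rw [Polynomial.constantCoeff_coe]; simp),
    hA₀, ← map_pow, ← PowerSeries.invOfUnit_one_pow _ hexp0]
  congr 2
  rw [← Polynomial.coe_pow, hpoly]
  exact map_prod Polynomial.coeToPowerSeries.ringHom _ _

end LocalIdentity

/-! ## Places of additive reduction -/

section Additive

variable (W : WeierstrassCurve ℚ) {m : ℕ}

/-- At a place of additive reduction of `E` the local Euler factor is `1` (`L_v(E, T) = 1`), and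
so is each of its twists by primitive characters. [folklore] -/
theorem prod_primitiveTwist_intCoe_localEulerFactor_eq_one_of_hasAdditiveReductionAt
    (s : Finset (DirichletCharacter ℂ m)) {v : HeightOneSpectrum (𝓞 ℚ)}
    (hv : W.HasAdditiveReductionAt v) :
    ∏ χ ∈ s, (toArithmeticFunction fun k : ℕ ↦ χ.primitiveCharacter (k : ZMod χ.conductor)).pmul
      (((W.baseChange (v.adicCompletion ℚ)).localEulerFactor (v.adicCompletionIntegers ℚ) :
        ArithmeticFunction ℤ) : ArithmeticFunction ℂ) = 1 := by
  refine Finset.prod_eq_one fun χ _ ↦ ?_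
  rw [W.localEulerFactor_baseChange_adicCompletion v, localPolynomialAt_of_hasAdditiveReductionAt hv,
    Polynomial.coe_one, PowerSeries.invOfUnit_one_eq_of_mul_eq_one (map_one _) (mul_one 1),
    map_one, intCoe_one, primitiveTwist_one χ]

end Additive

/-! ## The global identity of formal Euler products -/

section Global

variable (W : WeierstrassCurve ℚ) [W.IsElliptic] {m : ℕ} [NeZero m] (L : Type) [Field L]
  [NumberField L] [hL : IsCyclotomicExtension {m} ℚ L] (F : IntermediateField ℚ L)

include hL in
set_option maxHeartbeats 800000 in
/-- **Artin formalism for the formal Euler products, with primitive twists.**  Let `L ⊇ ℚ` be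
an `m`-th cyclotomic field, `F ⊆ L` with character group `X(F)`, `E/ℚ` an elliptic curve and `S`
the finite set of places of `ℚ` at which `E` is not semistable.  As formal Dirichlet series over
`ℂ`: `L(E_F) · ∏_{v ∈ S} ∏_{w ∣ v} L_w(E_F, N w^{-s}) = ∏_{χ ∈ X(F)} χ⋆ • L(E)`, where
`χ⋆ • L(E) = ∑ χ⋆(n) aₙ(E) n^{-s}` is the twist by the primitive character inducing `χ`: both
sides are Euler products over the places `v` of `ℚ` whose factors agree at the semistable `v`
by the local Artin identity (`intCoe_finprod_localEulerFactor_baseChange_eq_prod_primitiveTwist`)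
and are `1` at `v ∈ S` (additive reduction: `L_v(E, T) = 1`, and on the left the Euler factors
above `v` are cancelled).  (Ireland–Rosen Prop. 20.5.4 (b), the quadratic case.)
[cite: IrelandRosen1990, Ch. 20 §5, Prop. 20.5.4(b) (PDF p. 353)] -/
theorem intCoe_LFunction_baseChange_mul_eq_prod_primitiveTwist
    (S : Finset (HeightOneSpectrum (𝓞 ℚ))) (hS : ∀ v, v ∈ S ↔ ¬ W.IsSemistableAt v) :
    (((W.baseChange F).LFunction : ArithmeticFunction ℤ) : ArithmeticFunction ℂ) *
      ∏ v ∈ S, ((∏ᶠ w ∈ {w : HeightOneSpectrum (𝓞 F) | w.under (𝓞 ℚ) = v},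
        ofPowerSeries w.residueCard
          (((W.baseChange F).localPolynomialAt w : ℤ[X]) : PowerSeries ℤ) :
            ArithmeticFunction ℤ) : ArithmeticFunction ℂ) =
      ∏ χ ∈ ({χ | ∀ σ ∈ F.fixingSubgroup, χ (galEquivZMod m L σ) = 1} :
          Finset (DirichletCharacter ℂ m)),
        (toArithmeticFunction fun k : ℕ ↦ χ.primitiveCharacter (k : ZMod χ.conductor)).pmul
          ((W.LFunction : ArithmeticFunction ℤ) : ArithmeticFunction ℂ) := by
  -- convergence of the families of local factors
  have hΦc : ∀ n, ∀ᶠ v : HeightOneSpectrum (𝓞 ℚ) in cofinite,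
      (W.baseChange (v.adicCompletion ℚ)).localEulerFactor (v.adicCompletionIntegers ℚ) n =
        (1 : ArithmeticFunction ℤ) n :=
    W.eventually_cofinite_localEulerFactor_apply
  have hΦc' := eventually_intCoe_apply_eq_one hΦc
  have hΦFc : ∀ n, ∀ᶠ v : HeightOneSpectrum (𝓞 ℚ) in cofinite,
      (∏ᶠ w ∈ {w : HeightOneSpectrum (𝓞 F) | w.under (𝓞 ℚ) = v},
        ((W.baseChange F).baseChange (w.adicCompletion F)).localEulerFactor
          (w.adicCompletionIntegers F)) n = (1 : ArithmeticFunction ℤ) n :=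
    eventually_finprod_fiber_apply_eq_one _ (fun w : HeightOneSpectrum (𝓞 F) ↦ w.under (𝓞 ℚ))
      (fun v ↦ v.finite_setOf_under_eq_of_numberField)
      (W.baseChange F).eventually_cofinite_localEulerFactor_apply
  have hΦFc' := eventually_intCoe_apply_eq_one hΦFc
  -- the correction factors as a finitely supported family
  have hΨ1 : ∀ v ∉ S, (if v ∈ S then ((∏ᶠ w ∈ {w : HeightOneSpectrum (𝓞 F) | w.under (𝓞 ℚ) = v},
      ofPowerSeries w.residueCard (((W.baseChange F).localPolynomialAt w : ℤ[X]) : PowerSeries ℤ) :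
        ArithmeticFunction ℤ) : ArithmeticFunction ℂ) else 1) = 1 := fun v hv ↦ if_neg hv
  -- the left-hand side as one Euler product
  have hLHS : (((W.baseChange F).LFunction : ArithmeticFunction ℤ) : ArithmeticFunction ℂ) *
      ∏ v ∈ S, ((∏ᶠ w ∈ {w : HeightOneSpectrum (𝓞 F) | w.under (𝓞 ℚ) = v},
        ofPowerSeries w.residueCard
          (((W.baseChange F).localPolynomialAt w : ℤ[X]) : PowerSeries ℤ) :
            ArithmeticFunction ℤ) : ArithmeticFunction ℂ) =
      eulerProduct fun v : HeightOneSpectrum (𝓞 ℚ) ↦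
        ((∏ᶠ w ∈ {w : HeightOneSpectrum (𝓞 F) | w.under (𝓞 ℚ) = v},
          ((W.baseChange F).baseChange (w.adicCompletion F)).localEulerFactor
            (w.adicCompletionIntegers F) : ArithmeticFunction ℤ) : ArithmeticFunction ℂ) *
        (if v ∈ S then ((∏ᶠ w ∈ {w : HeightOneSpectrum (𝓞 F) | w.under (𝓞 ℚ) = v},
          ofPowerSeries w.residueCard
            (((W.baseChange F).localPolynomialAt w : ℤ[X]) : PowerSeries ℤ) :
              ArithmeticFunction ℤ) : ArithmeticFunction ℂ) else 1) := by
    rw [(W.baseChange F).LFunction_eq_eulerProduct_finprod_under ℚ, intCoe_eulerProduct _ hΦFc,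
      eulerProduct_mul_eq _ _ hΦFc' (eventually_apply_eq_one_of_eq_one S _ hΨ1),
      eulerProduct_eq_finset_prod_of_eq_one S _ hΨ1]
    exact congrArg _ (Finset.prod_congr rfl fun v hv ↦ (if_pos hv).symm)
  -- the right-hand side as one Euler product
  have hRHS : ∏ χ ∈ ({χ | ∀ σ ∈ F.fixingSubgroup, χ (galEquivZMod m L σ) = 1} :
      Finset (DirichletCharacter ℂ m)),
        (toArithmeticFunction fun k : ℕ ↦ χ.primitiveCharacter (k : ZMod χ.conductor)).pmul
          ((W.LFunction : ArithmeticFunction ℤ) : ArithmeticFunction ℂ) =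
      eulerProduct fun v : HeightOneSpectrum (𝓞 ℚ) ↦
        ∏ χ ∈ ({χ | ∀ σ ∈ F.fixingSubgroup, χ (galEquivZMod m L σ) = 1} :
            Finset (DirichletCharacter ℂ m)),
          (toArithmeticFunction fun k : ℕ ↦ χ.primitiveCharacter (k : ZMod χ.conductor)).pmul
            (((W.baseChange (v.adicCompletion ℚ)).localEulerFactor (v.adicCompletionIntegers ℚ) :
              ArithmeticFunction ℤ) : ArithmeticFunction ℂ) := by
    rw [W.LFunction_eq_eulerProduct, intCoe_eulerProduct _ hΦc,
      eulerProduct_finset_prod _ (fun (χ : DirichletCharacter ℂ m) (v : HeightOneSpectrum (𝓞 ℚ)) ↦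
        (toArithmeticFunction fun k : ℕ ↦ χ.primitiveCharacter (k : ZMod χ.conductor)).pmul
          (((W.baseChange (v.adicCompletion ℚ)).localEulerFactor (v.adicCompletionIntegers ℚ) :
            ArithmeticFunction ℤ) : ArithmeticFunction ℂ))
        (fun χ _ n ↦ eventually_primitiveTwist_apply_eq_one χ hΦc' n)]
    exact Finset.prod_congr rfl fun χ _ ↦ primitiveTwist_eulerProduct χ _ hΦc'
  rw [hLHS, hRHS]
  congr 1
  funext v
  by_cases hv : v ∈ S
  · -- a place of additive reduction: both sides are `1`
    have hv' : W.HasAdditiveReductionAt v := by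
      by_contra h
      exact (hS v).mp hv ((W.isSemistableAt_iff_not_hasAdditiveReductionAt v).mpr h)
    rw [if_pos hv, ← intCoe_mul, (W.baseChange F).finprod_localEulerFactor_mul_finprod_ofPowerSeries
      v.finite_setOf_under_eq_of_numberField, intCoe_one,
      W.prod_primitiveTwist_intCoe_localEulerFactor_eq_one_of_hasAdditiveReductionAt _ hv']
  · -- a semistable place: the local Artin identity
    rw [if_neg hv, mul_one]
    exact W.intCoe_finprod_localEulerFactor_baseChange_eq_prod_primitiveTwist L F v
      (by by_contra h; exact hv ((hS v).mpr h))

include hL in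
/-- **Artin formalism, exact form.**  If `E_F` has additive reduction at every place above a place
where `E` is not semistable (e.g. when such places are unramified in `F`, or absent), then
`L(E_F) = ∏_{χ ∈ X(F)} χ⋆ • L(E)` as formal Dirichlet series (the correcting factors
`∏_{w ∣ v} L_w(E_F, N w^{-s})` are all `1`). [cite: IrelandRosen1990, Ch. 20 §5, Prop. 20.5.4(b) (PDF p. 353)] -/
theorem intCoe_LFunction_baseChange_eq_prod_primitiveTwist_of_forall
    (hadd : ∀ v : HeightOneSpectrum (𝓞 ℚ), ¬ W.IsSemistableAt v →
      ∀ w : HeightOneSpectrum (𝓞 F), w.asIdeal.under (𝓞 ℚ) = v.asIdeal →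
        (W.baseChange F).HasAdditiveReductionAt w) :
    (((W.baseChange F).LFunction : ArithmeticFunction ℤ) : ArithmeticFunction ℂ) =
      ∏ χ ∈ ({χ | ∀ σ ∈ F.fixingSubgroup, χ (galEquivZMod m L σ) = 1} :
          Finset (DirichletCharacter ℂ m)),
        (toArithmeticFunction fun k : ℕ ↦ χ.primitiveCharacter (k : ZMod χ.conductor)).pmul
          ((W.LFunction : ArithmeticFunction ℤ) : ArithmeticFunction ℂ) := by
  set S := (WeierstrassCurve.finite_setOf_not_isSemistableAt (𝓞 ℚ) W).toFinset with hSdef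
  have hS : ∀ v, v ∈ S ↔ ¬ W.IsSemistableAt v := fun v ↦ by
    rw [hSdef, Set.Finite.mem_toFinset, Set.mem_setOf_eq]
  rw [← W.intCoe_LFunction_baseChange_mul_eq_prod_primitiveTwist L F S hS]
  symm
  convert mul_one _
  refine Finset.prod_eq_one fun v hv ↦ ?_
  rw [finprod_mem_of_eqOn_one fun w hw ↦ ?_, intCoe_one]
  have hw' : w.asIdeal.under (𝓞 ℚ) = v.asIdeal := congrArg HeightOneSpectrum.asIdeal hw
  change ofPowerSeries w.residueCard _ = 1
  rw [localPolynomialAt_of_hasAdditiveReductionAt (hadd v ((hS v).mp hv) w hw'),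
    Polynomial.coe_one, map_one]

include hL in
/-- **Artin formalism for a semistable curve**: if `E/ℚ` is semistable (good or multiplicative
reduction everywhere) then `L(E_F) = ∏_{χ ∈ X(F)} χ⋆ • L(E)` as formal Dirichlet series, for
every intermediate field `F` of an `m`-th cyclotomic field. [cite: IrelandRosen1990, Ch. 20 §5, Prop. 20.5.4(b) (PDF p. 353)] -/
theorem intCoe_LFunction_baseChange_eq_prod_primitiveTwist_of_isSemistable
    (hss : W.IsSemistable (𝓞 ℚ)) :
    (((W.baseChange F).LFunction : ArithmeticFunction ℤ) : ArithmeticFunction ℂ) =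
      ∏ χ ∈ ({χ | ∀ σ ∈ F.fixingSubgroup, χ (galEquivZMod m L σ) = 1} :
          Finset (DirichletCharacter ℂ m)),
        (toArithmeticFunction fun k : ℕ ↦ χ.primitiveCharacter (k : ZMod χ.conductor)).pmul
          ((W.LFunction : ArithmeticFunction ℤ) : ArithmeticFunction ℂ) :=
  W.intCoe_LFunction_baseChange_eq_prod_primitiveTwist_of_forall L F fun v hv ↦ absurd (hss v) hv

end Global

end WeierstrassCurve

end
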